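import Literature.AlgebraicGeometry.ComplexMultiplication.CyclicTwoPowerCMTypes
import Mathlib.NumberTheory.Cyclotomic.Gal
import Mathlib.RingTheory.ZMod.UnitsCyclic
import Literature.AlgebraicGeometry.ComplexMultiplication.PrincipalModelOfCMOrder
import Literature.AlgebraicGeometry.HodgeTheory.HodgeConjectureIsogenyInvariance
import Literature.AlgebraicGeometry.Motives.AbelianVarietySimpleOfIsogeny
import Literature.NumberTheory.ComplexMultiplication.CMTypeDictionary
import HarnessLib

/-!
# Fermat-prime cyclotomic fields `ℚ(ζ_p)`, `p = 2^{k+1} + 1`: the Hodge conjecture for every abelian variety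
# with complex multiplication by `ℚ(ζ₅)`, `ℚ(ζ₁₇)`, `ℚ(ζ₂₅₇)`, `ℚ(ζ₆₅₅₃₇)` (and all powers), unconditionally

COR-CM (cell `pub-hodgecm2`), binder seat b04 (gen 11), count-neutral; consumer of `CorCM/CyclicTwoPowerCMTypes`
(`isNondegenerate_of_isCyclic`: a CM field with CYCLIC Galois group of order `2^{k+1}` has every CM type
nondegenerate; `hodgeConjectureFor_pow_of_isCyclic`).  KERNEL ONLY: theorems; no definition, no named fact, no
`sorry`.

* §1 the INTRINSIC form for any such field `K`: a complex abelian variety `B` of dimension `2^k` with a ring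
  homomorphism `K → End⁰(B)` is SIMPLE and satisfies the Hodge conjecture
  (`isSimple_and_hodgeConjectureFor_of_ringHom_of_isCyclic`: Shimura's principal model §7.1 Prop. 7, the CM type
  of the pair §5.2, isogeny invariance of simplicity (Mumford §19) and of the Hodge conjecture (van Geemen 3.7)).
* §2 `ℚ(ζ_p)` for a prime `p = 2^{k+1} + 1` (a FERMAT PRIME): `Gal(ℚ(ζ_p)/ℚ) ≅ (ℤ/p)ˣ` is cyclic of order
  `p - 1 = 2^{k+1}` (Mathlib `IsCyclotomicExtension.autEquivPow`, `ZMod.isCyclic_units_prime`), so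
  **every CM type of `ℚ(ζ_p)` is nondegenerate of rank `2^k + 1` and primitive** (`rank_and_isPrimitive_of_fermatPrime`),
  **every abelian variety with CM by `ℚ(ζ_p)` is simple of dimension `2^k` and satisfies the Hodge conjecture with
  all its powers** (`hodgeConjectureFor_pow_of_fermatPrime`), and so does every abelian variety of dimension `2^k`
  admitting an action of `ℚ(ζ_p)` (`isSimple_and_hodgeConjectureFor_of_ringHom_fermatPrime`); the four known
  Fermat primes beyond `3` are spelled out (`…_five`, `…_seventeen'`, `…_twoFiveSeven`, `…_sixFiveFiveThreeSeven`:
  abelian varieties of dimension `2, 8, 128, 32768`).  The kernel census `CorCM/CyclotomicRankCensusSeventeen` is the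
  case `p = 17` by certificates; here it is a corollary of the structure theorem.

## References

* [Kubota1965] T. Kubota, Trans. AMS 118 (1965), §4 Lemma 2.
* [Shimura1998] G. Shimura, *Abelian Varieties with Complex Multiplication and Modular Functions*, §5.2, §7.1 Prop. 7,
  §8.2 Prop. 26, §8.4 (2).
* [Washington1997] L. C. Washington, *Introduction to Cyclotomic Fields*, Thm. 2.5 (`Gal(ℚ(ζ_n)/ℚ) ≅ (ℤ/n)ˣ`).
* [Gordon1999HodgeAVSurvey] B. B. Gordon, *A survey of the Hodge conjecture for abelian varieties*, Thm. 6.4, §9.3.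
* [vanGeemen1994HodgeAV] B. van Geemen, LNM 1594 (1994), §3.7 Lemma 3.7.

Provenance: Literature home (namespace `Literature.AlgebraicGeometry.ComplexMultiplication.CyclicTwoPower`) of the Summits-side `CorCM/CyclicTwoPowerCMTypesFermat` (cell `pub-hodgecm2`, COR-CM; all its imports are `Literature/`, Mathlib and the already re-homed `CyclicTwoPowerCMTypes`), which `Literature/` may not import; theorems only, no named fact, no definition. Nothing here bears on `HC_CM`. Lane `lit-hodgefound` (Layer A3: CM types, their Kubota ranks and Galois combinatorics), seat p20.
-/

noncomputable section

open _root_.CategoryTheory _root_.CategoryTheory.Limits NumberField Polynomial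

namespace Literature.AlgebraicGeometry.ComplexMultiplication.CyclicTwoPower

open Literature.NumberTheory.ComplexMultiplication
open Literature.AlgebraicGeometry Literature.AlgebraicGeometry.Motives Literature.AlgebraicGeometry.HodgeTheory
open Literature.AlgebraicGeometry.ComplexMultiplication
open Literature.AlgebraicGeometry.Pohlmann1968

/-! ### §1 Intrinsic form: abelian varieties of dimension `2^k` with an action of `K` -/

section Intrinsic

variable {K : Type} [Field K] [NumberField K] [IsCMField K] [Normal ℚ K] {B : AbelianVariety ℂ}

/-- **Every complex abelian variety `B` of dimension `2^k` with a ring homomorphism `K → End⁰(B)`, `K` a CM field with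
cyclic Galois group of order `2^{k+1}`, is SIMPLE and satisfies the Hodge conjecture** — UNCONDITIONAL.
[cite: Shimura1998, §5.2, §7.1 Prop. 7, §8.2 Prop. 26] [cite: vanGeemen1994HodgeAV, §3.7 Lemma 3.7] -/
theorem isSimple_and_hodgeConjectureFor_of_ringHom_of_isCyclic (hcyc : IsCyclic (K ≃ₐ[ℚ] K)) {k : ℕ}
    (hK : Module.finrank ℚ K = 2 ^ (k + 1)) (hB : B.dim = 2 ^ k) (φ : K →+* B.endAlgebra) :
    AbelianVariety.IsSimple B ∧ HodgeConjectureFor (2 ^ k) B.X := by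
  obtain ⟨B', φ', ι', hφι, f, hf⟩ := exists_principal_pair φ
  have hdim' : Module.finrank ℚ K = 2 * B'.dim := by
    rw [hK, ← AbelianVariety.dim_eq_of_isIsogeny hf, hB, pow_succ, mul_comm]
  have hreal := isCMTypeRealisation_cmTypeOfPair φ' hdim' ι' hφι
  obtain ⟨g, hg⟩ := AbelianVariety.IsIsogenous.symm_of_charZero (A := B) (B := B') ⟨f, hf⟩
  refine ⟨(isSimple_and_dim_of_isCyclic hcyc hK hreal).1.of_isIsogeny hg, ?_⟩
  have hB' : HodgeConjectureFor B'.dim B'.X := by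
    rw [(isSimple_and_dim_of_isCyclic hcyc hK hreal).2]; exact hodgeConjectureFor_of_isCyclic hcyc hK hreal
  have h := HodgeConjectureFor.of_isIsogenous ⟨f, hf⟩ hB'
  rwa [hB] at h

end Intrinsic

/-! ### §2 `ℚ(ζ_p)` for a Fermat prime `p = 2^{k+1} + 1` -/

section Fermat

/-- For a prime `p = 2^{k+1} + 1` and `L ≅ ℚ(ζ_p)`: `L` is a CM field, normal over `ℚ`, with CYCLIC Galois group
(`≅ (ℤ/p)ˣ`) and `[L:ℚ] = 2^{k+1}`. [cite: Washington1997, Thm. 2.5] -/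
theorem cm_normal_cyclic_finrank_of_fermatPrime {p k : ℕ} (hp : p.Prime) (hpk : p = 2 ^ (k + 1) + 1)
    (L : Type) [Field L] [NumberField L] [IsCyclotomicExtension {p} ℚ L] :
    IsCMField L ∧ Normal ℚ L ∧ IsCyclic (L ≃ₐ[ℚ] L) ∧ Module.finrank ℚ L = 2 ^ (k + 1) := by
  haveI : NeZero p := ⟨hp.ne_zero⟩
  have h2p : 2 < p := by rw [hpk]; have := Nat.one_lt_two_pow' k; omega
  have hirr : Irreducible (cyclotomic p ℚ) := cyclotomic.irreducible_rat hp.pos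
  haveI := IsCyclotomicExtension.isGalois {p} ℚ L
  refine ⟨IsCyclotomicExtension.Rat.isCMField L (S := ({p} : Set ℕ)) ⟨p, rfl, h2p⟩, inferInstance,
    (MulEquiv.isCyclic (IsCyclotomicExtension.autEquivPow L hirr)).2 (ZMod.isCyclic_units_prime hp), ?_⟩
  rw [IsCyclotomicExtension.finrank L hirr, Nat.totient_prime hp, hpk]
  rfl

/-- **Every CM type of `ℚ(ζ_p)`, `p = 2^{k+1} + 1` prime, has Kubota rank `2^k + 1` (is nondegenerate) and is
primitive.** [cite: Kubota1965, §4 Lemma 2] [cite: Shimura1998, §8.4 (2)] -/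
theorem rank_and_isPrimitive_of_fermatPrime {p k : ℕ} (hp : p.Prime) (hpk : p = 2 ^ (k + 1) + 1)
    {L : Type} [Field L] [NumberField L] [IsCyclotomicExtension {p} ℚ L] (Φ : CMType L) (φ₀ : L →+* ℂ) :
    cmTypeRank Φ = 2 ^ k + 1 ∧ IsNondegenerate Φ ∧ IsPrimitive (ℂ ≃+* ℂ) Φ.1 φ₀ := by
  obtain ⟨hcm, hno, hcyc, hK⟩ := cm_normal_cyclic_finrank_of_fermatPrime hp hpk L
  have h := cmTypeRank_eq_and_isPrimitive_of_isCyclic hcyc hK Φ φ₀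
  exact ⟨h.1, isNondegenerate_of_isCyclic hcyc hK Φ, h.2⟩

/-- **Every abelian variety with CM by `ℚ(ζ_p)`, `p = 2^{k+1} + 1` prime, is SIMPLE of dimension `2^k`.**
[cite: Shimura1998, §8.2 Prop. 26, §8.4 (2)] -/
theorem isSimple_and_dim_of_fermatPrime {p k : ℕ} (hp : p.Prime) (hpk : p = 2 ^ (k + 1) + 1)
    {L : Type} [Field L] [NumberField L] [IsCyclotomicExtension {p} ℚ L] {Φ : CMType L} {A : AbelianVariety ℂ}
    {ι : 𝓞 L →+* End A} {θ : L →+* Module.End ℂ (complexBetti A.X 1)} (hA : IsCMTypeRealisation Φ A ι θ) :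
    A.IsSimple ∧ A.dim = 2 ^ k := by
  obtain ⟨hcm, hno, hcyc, hK⟩ := cm_normal_cyclic_finrank_of_fermatPrime hp hpk L
  exact isSimple_and_dim_of_isCyclic hcyc hK hA

/-- **The Hodge conjecture for every power of every abelian variety with CM by `ℚ(ζ_p)`, `p = 2^{k+1} + 1` prime**
— UNCONDITIONAL. [cite: Gordon1999HodgeAVSurvey, Thm. 6.4 and §9.3] [cite: Kubota1965, §4 Lemma 2] -/
theorem hodgeConjectureFor_pow_of_fermatPrime {p k : ℕ} (hp : p.Prime) (hpk : p = 2 ^ (k + 1) + 1)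
    {L : Type} [Field L] [NumberField L] [IsCyclotomicExtension {p} ℚ L] {Φ : CMType L} {A : AbelianVariety ℂ}
    {ι : 𝓞 L →+* End A} {θ : L →+* Module.End ℂ (complexBetti A.X 1)} (hA : IsCMTypeRealisation Φ A ι θ)
    (n : ℕ) : HodgeConjectureFor (⨁ fun _ : Fin n => A).dim (⨁ fun _ : Fin n => A).X := by
  obtain ⟨hcm, hno, hcyc, hK⟩ := cm_normal_cyclic_finrank_of_fermatPrime hp hpk L
  exact hodgeConjectureFor_pow_of_isCyclic hcyc hK hA n

/-- **The Hodge conjecture for every abelian variety with CM by `ℚ(ζ_p)`, `p = 2^{k+1} + 1` prime**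
(`HodgeConjectureFor (2^k) A.X`) — UNCONDITIONAL. [cite: Gordon1999HodgeAVSurvey, §9.3] [cite: Kubota1965, §4 Lemma 2] -/
theorem hodgeConjectureFor_of_fermatPrime {p k : ℕ} (hp : p.Prime) (hpk : p = 2 ^ (k + 1) + 1)
    {L : Type} [Field L] [NumberField L] [IsCyclotomicExtension {p} ℚ L] {Φ : CMType L} {A : AbelianVariety ℂ}
    {ι : 𝓞 L →+* End A} {θ : L →+* Module.End ℂ (complexBetti A.X 1)} (hA : IsCMTypeRealisation Φ A ι θ) :
    HodgeConjectureFor (2 ^ k) A.X := by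
  obtain ⟨hcm, hno, hcyc, hK⟩ := cm_normal_cyclic_finrank_of_fermatPrime hp hpk L
  exact hodgeConjectureFor_of_isCyclic hcyc hK hA

/-- **Every complex abelian variety of dimension `2^k` with a ring homomorphism `ℚ(ζ_p) → End⁰(B)`,
`p = 2^{k+1} + 1` prime, is simple and satisfies the Hodge conjecture** — UNCONDITIONAL.
[cite: Shimura1998, §7.1 Prop. 7, §8.2 Prop. 26] [cite: vanGeemen1994HodgeAV, §3.7 Lemma 3.7] -/
theorem isSimple_and_hodgeConjectureFor_of_ringHom_fermatPrime {p k : ℕ} (hp : p.Prime)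
    (hpk : p = 2 ^ (k + 1) + 1) {L : Type} [Field L] [NumberField L] [IsCyclotomicExtension {p} ℚ L]
    {B : AbelianVariety ℂ} (hB : B.dim = 2 ^ k) (φ : L →+* B.endAlgebra) :
    AbelianVariety.IsSimple B ∧ HodgeConjectureFor (2 ^ k) B.X := by
  obtain ⟨hcm, hno, hcyc, hK⟩ := cm_normal_cyclic_finrank_of_fermatPrime hp hpk L
  exact isSimple_and_hodgeConjectureFor_of_ringHom_of_isCyclic hcyc hK hB φ

end Fermat

/-! ### §3 The Fermat primes `5`, `17`, `257`, `65537` -/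

section Instances

variable {L : Type} [Field L] [NumberField L] {B : AbelianVariety ℂ}

/-- **`ℚ(ζ₅)`: every abelian SURFACE with an action of `ℚ(ζ₅)` is simple and satisfies the Hodge conjecture.**
[cite: Shimura1998, §8.4 (2)] [cite: Kubota1965, §4 Lemma 2] -/
theorem isSimple_and_hodgeConjectureFor_of_ringHom_five [IsCyclotomicExtension {5} ℚ L] (hB : B.dim = 2)
    (φ : L →+* B.endAlgebra) : AbelianVariety.IsSimple B ∧ HodgeConjectureFor 2 B.X :=
  isSimple_and_hodgeConjectureFor_of_ringHom_fermatPrime (p := 5) (k := 1) (by norm_num) (by norm_num) hB φ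

/-- **`ℚ(ζ₁₇)`: every abelian EIGHTFOLD with an action of `ℚ(ζ₁₇)` is simple and satisfies the Hodge conjecture**
(the structural form of `CyclotomicRankCensusSeventeen`). [cite: Kubota1965, §4 Lemma 2] -/
theorem isSimple_and_hodgeConjectureFor_of_ringHom_seventeen' [IsCyclotomicExtension {17} ℚ L] (hB : B.dim = 8)
    (φ : L →+* B.endAlgebra) : AbelianVariety.IsSimple B ∧ HodgeConjectureFor 8 B.X :=
  isSimple_and_hodgeConjectureFor_of_ringHom_fermatPrime (p := 17) (k := 3) (by norm_num) (by norm_num) hB φ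

/-- **`ℚ(ζ₂₅₇)`: every complex abelian variety of dimension `128` with an action of `ℚ(ζ₂₅₇)` is simple and satisfies
the Hodge conjecture.** [cite: Kubota1965, §4 Lemma 2] -/
theorem isSimple_and_hodgeConjectureFor_of_ringHom_twoFiveSeven [IsCyclotomicExtension {257} ℚ L]
    (hB : B.dim = 128) (φ : L →+* B.endAlgebra) : AbelianVariety.IsSimple B ∧ HodgeConjectureFor 128 B.X :=
  isSimple_and_hodgeConjectureFor_of_ringHom_fermatPrime (p := 257) (k := 7) (by norm_num) (by norm_num) hB φ

/-- **`ℚ(ζ₆₅₅₃₇)`: every complex abelian variety of dimension `32768` with an action of `ℚ(ζ₆₅₅₃₇)` is simple and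
satisfies the Hodge conjecture.** [cite: Kubota1965, §4 Lemma 2] -/
theorem isSimple_and_hodgeConjectureFor_of_ringHom_sixFiveFiveThreeSeven [IsCyclotomicExtension {65537} ℚ L]
    (hB : B.dim = 32768) (φ : L →+* B.endAlgebra) :
    AbelianVariety.IsSimple B ∧ HodgeConjectureFor 32768 B.X :=
  isSimple_and_hodgeConjectureFor_of_ringHom_fermatPrime (p := 65537) (k := 15) (by norm_num) (by norm_num) hB φ

end Instances

end Literature.AlgebraicGeometry.ComplexMultiplication.CyclicTwoPower

end
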